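import Summits.ValiantsHypothesis.ValiantsHypothesis.Theorems.DefinabilityGapFourGatesShared
import HarnessLib

/-!
# Definability gap — GRAPHICAL ΣΠΣ(4) WITH SHARED EDGES: the edge-rich regime and square-free gates (O-L5-SURPLUS, F-S₂)

Helper instrument for `stmt-ValiantsHypothesis-23704` (KI planted hitting, route `DefinabilityGap`), in the
restricted-model cell (α″)/(CL4) «graphical ΣΠΣ(4) circuits with shared edges». Gates `eprod E = Π_{(u,v) ∈ E}
(z_u − z_v)` over ORIENTED edge multisets (`toLex u < toLex v`), `G_m = φ = bind₁ (kiPer m)`, the relabel-collapse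
`ρ_e = rename (repL [e])` (`z_{e.2} ↦ z_{e.1}`), `U :=` the set of distinct edges of the four gates.

## Contents

* `exists_free_collapse_of_totalDegree_lt` — SURPLUS ⟹ FREE (pure z-side, fan-in-free): a nonzero `f` cannot be
  annihilated by the collapses of more oriented edges than its total degree (contrapositive of the tree's DIVISOR
  COUNT `card_le_totalDegree_of_rename_eq_zero`, `DefinabilityGapMasonStothers`: every such `z_u − z_v` divides `f`).
* ★ `kiPer_hits_graphicalFour_surplus` — THEOREM C (EDGE-RICH regime): four gates of one size `n` with `|U| > n`,
  arbitrary shared and repeated edges: `deg f ≤ n < |U|` gives a FREE edge, and the FREE COLLAPSE WITH SHARED EDGES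
  `kiPer_fourGates_free_shared` (`DefinabilityGapFourGatesShared`: THEOREM A at level `[e]`, zero-padded over the
  gates killed by `ρ_e`) closes after the rotation bringing the gate of `e` first. There is NO stuck branch.
* `kiPer_hits_graphicalFour_nodup_ne` — two DISTINCT SQUARE-FREE gates among the four suffice, any sizes: the SIZES
  REDUCTION `kiPer_hits_graphicalFour_of_eqCard` and, at equal sizes, `|U| ≥ n + 1` (two distinct `n`-subsets of `U`).
* ★★ `kiPer_hits_graphicalFour_squarefree` — THEOREM C′: every nonzero sum of FOUR SQUARE-FREE graphical gates on
  oriented edges is hit by `G_m` (`m ≥ 8`) — any sizes, ANY sharing pattern, every union support (if the four gates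
  coincide, `f = (Σα)·eprod E` and `kiPer_eprod_ne_zero`).

HONEST BOUNDARY (O-L5-SURPLUS): proved here are, for m ≥ 8 and graphical gates on ORIENTED edges: (C) hitting by
G_m of every nonzero sum of FOUR gates of one size n whose union support has more than n distinct edges — arbitrary
shared and repeated edges, every union support — and (C′) of every nonzero sum of FOUR SQUARE-FREE gates of any sizes
and any sharing pattern; the free collapse with shared edges and the sizes reduction are tools; NOT claimed: four
gates of one size n with at most n distinct edges in the union when some gate repeats an edge and some edge is shared
by two or three gates (the EDGE-POOR residual of (CL4): it needs a label bound for stuck circuits, not done), five or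
more gates (the free recursion meets edge-poor stuck circuits one level down), the k-set label bound, affine
non-graphical forms (β), the leaf regime (γ); nothing here is S-currency, no item closes, stmt-23704 and VP ≠ VNP are
untouched.

LABEL (critic g12, RULING bus 3348, verbatim): «O-L5-SURPLUS (lens-5 g41): ELEMENTARY · NEW-COMBINATION (levers EACH
already used on this line — g39's free/stuck dichotomy and its fan-in-free DIVISOR COUNT
`card_le_totalDegree_of_rename_eq_zero` (GraphicalThree, there at k = 3 and only together with Mason–Stothers), g40's
THEOREM A `wordL_threeGates_eqCard` at level [e] and THEOREM B's free step / (Z)+(S) sizes reduction — JOINED as a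
REGIME SPLIT edge-rich |U| > n / edge-poor |U| ≤ n: the stuck branch, the only consumer of edge-disjointness in
THEOREM B, is EMPTY in the edge-rich regime, and the free collapse is run with SHARED edges by zero-padding the killed
gates; Mason-free, primality-free, slide-free; the junction and the reach — shared edges at fan-in 4 — are new, no new
lever) · PROVES (restricted-model hitting cells of (α″)/(CL4) only, m ≥ 8, oriented edges): (C) G_m hits every
nonzero sum of FOUR graphical gates of one size n whose union support has MORE than n distinct edges — arbitrary
shared and repeated edges, every union support; (C′) G_m hits every nonzero sum of FOUR SQUARE-FREE graphical gates —
any sizes, ANY sharing pattern, every union support · NOT decided: the EDGE-POOR residual of (CL4) (|U| ≤ n with a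
repeated edge inside a gate AND an edge shared by two or three gates — needs a LABEL bound for stuck circuits; «stuck
⟹ f = 0» is FALSE there, witnesses {3M₁, 3M₂, 3M₃, M₁+M₂+M₃} on the K₄ matchings and the triangle family), fan-in
≥ 5, the k-set label bound GRB_k (now reduced to edge-poor stuck circuits), (β) affine non-graphical, (γ) leaf regime
— UNDECIDED · IDEA-NEEDED · print status: elementary PIT for a toy depth-3 class, no print claim either way · 0
S-currency · closes NO item · stmt-23704 TEXT / K1 / VP ≠ VNP untouched».

BY-NAME reuse, no re-proofs, no edits of tree files: `card_le_totalDegree_of_rename_eq_zero`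
(`DefinabilityGapMasonStothers`), `kiPer_fourGates_free_shared`, `kiPer_hits_graphicalFour_of_eqCard`
(`DefinabilityGapFourGatesShared`), `totalDegree_eprod_le`, `kiPer_eprod_ne_zero` (`DefinabilityGapEdgeGates`).
Citations in prose only: Kabanets–Impagliazzo 2003, Nisan–Wigderson 1994 (the lane).
-/

open MvPolynomial
open Literature.Computability.AlgebraicComplexity Literature.Computability.MetaComplexity
open Summit.ValiantsHypothesis.ValiantsHypothesis.Theorems.DefinabilityGapAffineRung
open Summit.ValiantsHypothesis.ValiantsHypothesis.Theorems.DefinabilityGapBlockMerging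
open Summit.ValiantsHypothesis.ValiantsHypothesis.Theorems.DefinabilityGapClusterMerging
open Summit.ValiantsHypothesis.ValiantsHypothesis.Theorems.DefinabilityGapForestSums
open Summit.ValiantsHypothesis.ValiantsHypothesis.Theorems.DefinabilityGapSupportRung
open Summit.ValiantsHypothesis.ValiantsHypothesis.Theorems.DefinabilityGapEdgeGates
open Summit.ValiantsHypothesis.ValiantsHypothesis.Theorems.DefinabilityGapMasonStothers
open Summit.ValiantsHypothesis.ValiantsHypothesis.Theorems.DefinabilityGapSlideCount
open Summit.ValiantsHypothesis.ValiantsHypothesis.Theorems.DefinabilityGapSlideSupport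
open Summit.ValiantsHypothesis.ValiantsHypothesis.Theorems.DefinabilityGapThreeGatesPatched
open Summit.ValiantsHypothesis.ValiantsHypothesis.Theorems.DefinabilityGapGraphicalThree
open Summit.ValiantsHypothesis.ValiantsHypothesis.Theorems.DefinabilityGapFourGatesTools
open Summit.ValiantsHypothesis.ValiantsHypothesis.Theorems.DefinabilityGapGraphicalFour
open Summit.ValiantsHypothesis.ValiantsHypothesis.Theorems.DefinabilityGapFourGatesShared

set_option linter.dupNamespace false

namespace Summit.ValiantsHypothesis.ValiantsHypothesis.Theorems.DefinabilityGapGraphicalFourSurplus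

variable {m : ℕ}

/-! ## 1. Surplus forces a free collapse -/

/-- SURPLUS ⟹ FREE (pure z-side, fan-in-free): a nonzero `f` annihilated by the collapses of MORE oriented edges
than its total degree does not exist — contrapositive of the tree's divisor count
`card_le_totalDegree_of_rename_eq_zero`. -/
theorem exists_free_collapse_of_totalDegree_lt {f : MvPolynomial (Fin 3 → Fin (qOf m)) ℂ} (hf : f ≠ 0)
    (U : Finset ((Fin 3 → Fin (qOf m)) × (Fin 3 → Fin (qOf m)))) (ho : ∀ e ∈ U, toLex e.1 < toLex e.2)
    (hU : f.totalDegree < U.card) : ∃ e ∈ U, rename (repL [e]) f ≠ 0 := by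
  by_contra hst
  refine absurd hU (not_lt.2 (card_le_totalDegree_of_rename_eq_zero U hf
    (fun e he h => (ho e he).ne (congrArg toLex h)) (fun e he e' he' _ h => ?_) (fun e he => ?_)))
  · have h1 := ho e he
    rw [h] at h1
    exact lt_asymm (ho e' he') h1
  · have hρ : (fun c : Fin 3 → Fin (qOf m) => if c = e.2 then e.1 else c) = repL [e] := funext fun c => rfl
    rw [hρ]
    by_contra h
    exact hst ⟨e, he, h⟩

/-! ## 2. THEOREM C: the edge-rich regime -/

/-- ★ THEOREM C (SURPLUS): `G_m` hits every nonzero graphical ΣΠΣ(4) circuit with gates of one size `n` on oriented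
edges whose union support has MORE THAN `n` distinct edges — ANY sharing pattern (common edges, doubly-shared edges,
repeated edges), every union support, `m ≥ 8`. -/
theorem kiPer_hits_graphicalFour_surplus (hm : 8 ≤ m)
    {E₁ E₂ E₃ E₄ : Multiset ((Fin 3 → Fin (qOf m)) × (Fin 3 → Fin (qOf m)))}
    (ho : ∀ e ∈ E₁ + E₂ + E₃ + E₄, toLex e.1 < toLex e.2)
    (c₂ : Multiset.card E₂ = Multiset.card E₁) (c₃ : Multiset.card E₃ = Multiset.card E₁)
    (c₄ : Multiset.card E₄ = Multiset.card E₁)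
    (hU : Multiset.card E₁ < (E₁ + E₂ + E₃ + E₄).toFinset.card) {α₁ α₂ α₃ α₄ : ℂ}
    (hf : C α₁ * eprod E₁ + C α₂ * eprod E₂ + C α₃ * eprod E₃ + C α₄ * eprod E₄ ≠ 0) :
    bind₁ (kiPer m) (C α₁ * eprod E₁ + C α₂ * eprod E₂ + C α₃ * eprod E₃ + C α₄ * eprod E₄) ≠ 0 := by
  intro h0
  have mE₁ : ∀ d ∈ E₁, d ∈ E₁ + E₂ + E₃ + E₄ := fun d hd =>
    Multiset.mem_add.2 (Or.inl (Multiset.mem_add.2 (Or.inl (Multiset.mem_add.2 (Or.inl hd)))))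
  have mE₂ : ∀ d ∈ E₂, d ∈ E₁ + E₂ + E₃ + E₄ := fun d hd =>
    Multiset.mem_add.2 (Or.inl (Multiset.mem_add.2 (Or.inl (Multiset.mem_add.2 (Or.inr hd)))))
  have ho₁ : ∀ e ∈ E₁, toLex e.1 < toLex e.2 := fun e he => ho e (mE₁ e he)
  have ho₂ : ∀ e ∈ E₂, toLex e.1 < toLex e.2 := fun e he => ho e (mE₂ e he)
  have ho₃ : ∀ e ∈ E₃, toLex e.1 < toLex e.2 := fun e he =>
    ho e (Multiset.mem_add.2 (Or.inl (Multiset.mem_add.2 (Or.inr he))))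
  have ho₄ : ∀ e ∈ E₄, toLex e.1 < toLex e.2 := fun e he => ho e (Multiset.mem_add.2 (Or.inr he))
  have ho' : ∀ {P Q R S : Multiset ((Fin 3 → Fin (qOf m)) × (Fin 3 → Fin (qOf m)))},
      (∀ d ∈ P, toLex d.1 < toLex d.2) → (∀ d ∈ Q, toLex d.1 < toLex d.2) → (∀ d ∈ R, toLex d.1 < toLex d.2) →
      (∀ d ∈ S, toLex d.1 < toLex d.2) → ∀ d ∈ P + Q + R + S, toLex d.1 < toLex d.2 := by
    intro P Q R S hP hQ hR hS d hd
    rcases Multiset.mem_add.1 hd with hd | hd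
    · rcases Multiset.mem_add.1 hd with hd | hd
      · rcases Multiset.mem_add.1 hd with hd | hd
        exacts [hP d hd, hQ d hd]
      · exact hR d hd
    · exact hS d hd
  -- `deg f ≤ n < |U|`: a FREE collapse exists — there is no stuck branch
  have hdeg : (C α₁ * eprod E₁ + C α₂ * eprod E₂ + C α₃ * eprod E₃ + C α₄ * eprod E₄).totalDegree ≤
      Multiset.card E₁ := by
    have hg : ∀ (F : Multiset ((Fin 3 → Fin (qOf m)) × (Fin 3 → Fin (qOf m)))) (γ : ℂ),
        Multiset.card F = Multiset.card E₁ → (C γ * eprod F).totalDegree ≤ Multiset.card E₁ := fun F γ hF =>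
      (totalDegree_mul _ _).trans (by rw [totalDegree_C, zero_add, ← hF]; exact totalDegree_eprod_le F)
    exact (totalDegree_add _ _).trans (max_le ((totalDegree_add _ _).trans (max_le ((totalDegree_add _ _).trans
      (max_le (hg E₁ α₁ rfl) (hg E₂ α₂ c₂))) (hg E₃ α₃ c₃))) (hg E₄ α₄ c₄))
  obtain ⟨e, he, hρ⟩ := exists_free_collapse_of_totalDegree_lt hf (E₁ + E₂ + E₃ + E₄).toFinset
    (fun e he => ho e (Multiset.mem_toFinset.1 he)) (lt_of_le_of_lt hdeg hU)
  rw [Multiset.mem_toFinset] at he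
  -- rotate the gate of `e` first and run the FREE COLLAPSE WITH SHARED EDGES
  rcases Multiset.mem_add.1 he with he | he₄
  · rcases Multiset.mem_add.1 he with he | he₃
    · rcases Multiset.mem_add.1 he with he₁ | he₂
      · exact kiPer_fourGates_free_shared hm ho (c₃.trans c₂.symm) (c₄.trans c₂.symm) he₁ hρ h0
      · have ef : C α₂ * eprod E₂ + C α₁ * eprod E₁ + C α₃ * eprod E₃ + C α₄ * eprod E₄ =
            C α₁ * eprod E₁ + C α₂ * eprod E₂ + C α₃ * eprod E₃ + C α₄ * eprod E₄ := by ring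
        refine kiPer_fourGates_free_shared hm (F₁ := E₂) (F₂ := E₁) (F₃ := E₃) (F₄ := E₄) (γ₁ := α₂) (γ₂ := α₁)
          (γ₃ := α₃) (γ₄ := α₄) (ho' ho₂ ho₁ ho₃ ho₄) c₃ c₄ he₂ ?_ ?_
        · rw [ef]; exact hρ
        · rw [ef]; exact h0
    · have ef : C α₃ * eprod E₃ + C α₁ * eprod E₁ + C α₂ * eprod E₂ + C α₄ * eprod E₄ =
          C α₁ * eprod E₁ + C α₂ * eprod E₂ + C α₃ * eprod E₃ + C α₄ * eprod E₄ := by ring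
      refine kiPer_fourGates_free_shared hm (F₁ := E₃) (F₂ := E₁) (F₃ := E₂) (F₄ := E₄) (γ₁ := α₃) (γ₂ := α₁)
        (γ₃ := α₂) (γ₄ := α₄) (ho' ho₃ ho₁ ho₂ ho₄) c₂ c₄ he₃ ?_ ?_
      · rw [ef]; exact hρ
      · rw [ef]; exact h0
  · have ef : C α₄ * eprod E₄ + C α₁ * eprod E₁ + C α₂ * eprod E₂ + C α₃ * eprod E₃ =
        C α₁ * eprod E₁ + C α₂ * eprod E₂ + C α₃ * eprod E₃ + C α₄ * eprod E₄ := by ring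
    refine kiPer_fourGates_free_shared hm (F₁ := E₄) (F₂ := E₁) (F₃ := E₂) (F₄ := E₃) (γ₁ := α₄) (γ₂ := α₁)
      (γ₃ := α₂) (γ₄ := α₃) (ho' ho₄ ho₁ ho₂ ho₃) c₂ c₃ he₄ ?_ ?_
    · rw [ef]; exact hρ
    · rw [ef]; exact h0

/-! ## 3. THEOREM C′: square-free gates -/

/-- TWO DISTINCT SQUARE-FREE GATES suffice (any sizes, any sharing, `m ≥ 8`). -/
theorem kiPer_hits_graphicalFour_nodup_ne (hm : 8 ≤ m)
    {E₁ E₂ E₃ E₄ : Multiset ((Fin 3 → Fin (qOf m)) × (Fin 3 → Fin (qOf m)))}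
    (ho : ∀ e ∈ E₁ + E₂ + E₃ + E₄, toLex e.1 < toLex e.2) (hn₁ : E₁.Nodup) (hn₂ : E₂.Nodup) (h₁₂ : E₁ ≠ E₂)
    {α₁ α₂ α₃ α₄ : ℂ} (hf : C α₁ * eprod E₁ + C α₂ * eprod E₂ + C α₃ * eprod E₃ + C α₄ * eprod E₄ ≠ 0) :
    bind₁ (kiPer m) (C α₁ * eprod E₁ + C α₂ * eprod E₂ + C α₃ * eprod E₃ + C α₄ * eprod E₄) ≠ 0 := by
  have hm5 : 5 ≤ m := by omega
  have mE₁ : ∀ d ∈ E₁, d ∈ E₁ + E₂ + E₃ + E₄ := fun d hd =>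
    Multiset.mem_add.2 (Or.inl (Multiset.mem_add.2 (Or.inl (Multiset.mem_add.2 (Or.inl hd)))))
  have mE₂ : ∀ d ∈ E₂, d ∈ E₁ + E₂ + E₃ + E₄ := fun d hd =>
    Multiset.mem_add.2 (Or.inl (Multiset.mem_add.2 (Or.inl (Multiset.mem_add.2 (Or.inr hd)))))
  have ho₁ : ∀ e ∈ E₁, toLex e.1 < toLex e.2 := fun e he => ho e (mE₁ e he)
  have ho₂ : ∀ e ∈ E₂, toLex e.1 < toLex e.2 := fun e he => ho e (mE₂ e he)
  have ho₃ : ∀ e ∈ E₃, toLex e.1 < toLex e.2 := fun e he =>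
    ho e (Multiset.mem_add.2 (Or.inl (Multiset.mem_add.2 (Or.inr he))))
  have ho₄ : ∀ e ∈ E₄, toLex e.1 < toLex e.2 := fun e he => ho e (Multiset.mem_add.2 (Or.inr he))
  refine kiPer_hits_graphicalFour_of_eqCard hm5 ho₁ ho₂ ho₃ ho₄ (fun c₂ c₃ c₄ => ?_) hf
  refine kiPer_hits_graphicalFour_surplus hm ho c₂ c₃ c₄ ?_ hf
  -- two distinct `n`-subsets of `U`: `|U| ≥ n + 1`
  have hs₁ : E₁.toFinset ⊆ (E₁ + E₂ + E₃ + E₄).toFinset := fun d hd =>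
    Multiset.mem_toFinset.2 (mE₁ d (Multiset.mem_toFinset.1 hd))
  have hs₂ : E₂.toFinset ⊆ (E₁ + E₂ + E₃ + E₄).toFinset := fun d hd =>
    Multiset.mem_toFinset.2 (mE₂ d (Multiset.mem_toFinset.1 hd))
  have k₁ : E₁.toFinset.card = Multiset.card E₁ := Multiset.toFinset_card_of_nodup hn₁
  have k₂ : E₂.toFinset.card = Multiset.card E₁ := (Multiset.toFinset_card_of_nodup hn₂).trans c₂
  have hne : E₁.toFinset ≠ E₂.toFinset := fun h => h₁₂ (Multiset.Nodup.toFinset_inj hn₁ hn₂ h)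
  by_contra hle
  rw [not_lt] at hle
  have h1 : E₁.toFinset = (E₁ + E₂ + E₃ + E₄).toFinset :=
    Finset.eq_of_subset_of_card_le hs₁ (by rw [k₁]; exact hle)
  have h2 : E₂.toFinset = (E₁ + E₂ + E₃ + E₄).toFinset :=
    Finset.eq_of_subset_of_card_le hs₂ (by rw [k₂]; exact hle)
  exact hne (h1.trans h2.symm)

/-- ★★ THEOREM C′ (SQUARE-FREE GATES): `G_m` hits every nonzero graphical ΣΠΣ(4) circuit whose four gates are
square-free products of `z_u − z_v` over oriented edges — any sizes, ANY sharing pattern, every union support, `m ≥ 8`.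
-/
theorem kiPer_hits_graphicalFour_squarefree (hm : 8 ≤ m)
    {E₁ E₂ E₃ E₄ : Multiset ((Fin 3 → Fin (qOf m)) × (Fin 3 → Fin (qOf m)))}
    (ho : ∀ e ∈ E₁ + E₂ + E₃ + E₄, toLex e.1 < toLex e.2)
    (hn₁ : E₁.Nodup) (hn₂ : E₂.Nodup) (hn₃ : E₃.Nodup) (hn₄ : E₄.Nodup) {α₁ α₂ α₃ α₄ : ℂ}
    (hf : C α₁ * eprod E₁ + C α₂ * eprod E₂ + C α₃ * eprod E₃ + C α₄ * eprod E₄ ≠ 0) :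
    bind₁ (kiPer m) (C α₁ * eprod E₁ + C α₂ * eprod E₂ + C α₃ * eprod E₃ + C α₄ * eprod E₄) ≠ 0 := by
  have hm3 : 3 ≤ m := by omega
  have mE₁ : ∀ d ∈ E₁, d ∈ E₁ + E₂ + E₃ + E₄ := fun d hd =>
    Multiset.mem_add.2 (Or.inl (Multiset.mem_add.2 (Or.inl (Multiset.mem_add.2 (Or.inl hd)))))
  have mE₂ : ∀ d ∈ E₂, d ∈ E₁ + E₂ + E₃ + E₄ := fun d hd =>
    Multiset.mem_add.2 (Or.inl (Multiset.mem_add.2 (Or.inl (Multiset.mem_add.2 (Or.inr hd)))))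
  have ho₁ : ∀ e ∈ E₁, toLex e.1 < toLex e.2 := fun e he => ho e (mE₁ e he)
  have ho₂ : ∀ e ∈ E₂, toLex e.1 < toLex e.2 := fun e he => ho e (mE₂ e he)
  have ho₃ : ∀ e ∈ E₃, toLex e.1 < toLex e.2 := fun e he =>
    ho e (Multiset.mem_add.2 (Or.inl (Multiset.mem_add.2 (Or.inr he))))
  have ho₄ : ∀ e ∈ E₄, toLex e.1 < toLex e.2 := fun e he => ho e (Multiset.mem_add.2 (Or.inr he))
  have ho' : ∀ {P Q R S : Multiset ((Fin 3 → Fin (qOf m)) × (Fin 3 → Fin (qOf m)))},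
      (∀ d ∈ P, toLex d.1 < toLex d.2) → (∀ d ∈ Q, toLex d.1 < toLex d.2) → (∀ d ∈ R, toLex d.1 < toLex d.2) →
      (∀ d ∈ S, toLex d.1 < toLex d.2) → ∀ d ∈ P + Q + R + S, toLex d.1 < toLex d.2 := by
    intro P Q R S hP hQ hR hS d hd
    rcases Multiset.mem_add.1 hd with hd | hd
    · rcases Multiset.mem_add.1 hd with hd | hd
      · rcases Multiset.mem_add.1 hd with hd | hd
        exacts [hP d hd, hQ d hd]
      · exact hR d hd
    · exact hS d hd
  by_cases h₁₂ : E₁ = E₂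
  · by_cases h₁₃ : E₁ = E₃
    · by_cases h₁₄ : E₁ = E₄
      · -- the four gates coincide: `f = (Σα) · eprod E₁`
        have hl : ∀ e ∈ E₁, e.1 ≠ e.2 := fun e he h => (ho₁ e he).ne (congrArg toLex h)
        have ef : C α₁ * eprod E₁ + C α₂ * eprod E₂ + C α₃ * eprod E₃ + C α₄ * eprod E₄ =
            C (α₁ + α₂ + α₃ + α₄) * eprod E₁ := by
          rw [← h₁₂, ← h₁₃, ← h₁₄, map_add, map_add, map_add]; ring
        rw [ef] at hf ⊢
        have hs : α₁ + α₂ + α₃ + α₄ ≠ 0 := fun h => hf (by rw [h, C_0, zero_mul])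
        rw [map_mul, bind₁_C_right]
        exact mul_ne_zero (C_ne_zero.2 hs) (kiPer_eprod_ne_zero hm3 hl)
      · have ef : C α₁ * eprod E₁ + C α₄ * eprod E₄ + C α₃ * eprod E₃ + C α₂ * eprod E₂ =
            C α₁ * eprod E₁ + C α₂ * eprod E₂ + C α₃ * eprod E₃ + C α₄ * eprod E₄ := by ring
        have h := kiPer_hits_graphicalFour_nodup_ne hm (E₁ := E₁) (E₂ := E₄) (E₃ := E₃) (E₄ := E₂) (α₁ := α₁)
          (α₂ := α₄) (α₃ := α₃) (α₄ := α₂) (ho' ho₁ ho₄ ho₃ ho₂) hn₁ hn₄ h₁₄ (by rw [ef]; exact hf)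
        rw [ef] at h
        exact h
    · have ef : C α₁ * eprod E₁ + C α₃ * eprod E₃ + C α₂ * eprod E₂ + C α₄ * eprod E₄ =
          C α₁ * eprod E₁ + C α₂ * eprod E₂ + C α₃ * eprod E₃ + C α₄ * eprod E₄ := by ring
      have h := kiPer_hits_graphicalFour_nodup_ne hm (E₁ := E₁) (E₂ := E₃) (E₃ := E₂) (E₄ := E₄) (α₁ := α₁)
        (α₂ := α₃) (α₃ := α₂) (α₄ := α₄) (ho' ho₁ ho₃ ho₂ ho₄) hn₁ hn₃ h₁₃ (by rw [ef]; exact hf)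
      rw [ef] at h
      exact h
  · exact kiPer_hits_graphicalFour_nodup_ne hm ho hn₁ hn₂ h₁₂ hf

end Summit.ValiantsHypothesis.ValiantsHypothesis.Theorems.DefinabilityGapGraphicalFourSurplus
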